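import Mathlib.Analysis.Calculus.ImplicitContDiff
import Mathlib.Analysis.Calculus.Deriv.Polynomial
import Mathlib.Analysis.Polynomial.CauchyBound
import Mathlib.FieldTheory.IsAlgClosed.Basic
import Mathlib.RingTheory.Polynomial.Vieta
import Literature.NumberTheory.Transcendental.PolynomialOnLines
import HarnessLib

/-!
# The unramified part of a hypersurface `F(z, t) = 0` over `ℂʳ` is connected

This file proves the analytic heart of Shafarevich's second proof that an irreducible variety over
`ℂ` is connected (*Basic Algebraic Geometry 2*, VII §2.3): let `B = ℂ[z₁, …, z_r]`, let
`F ∈ B[T]` be monic of positive degree which is not a product of two monic polynomials of positive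
degree, and let `g ∈ B`, `g ≠ 0`, be such that `F(z, ·)` has simple roots whenever `g(z) ≠ 0`.
Then the «unramified cover»

  `H = {(z, t) ∈ ℂʳ × ℂ | g(z) ≠ 0, F(z, t) = 0}`   of   `V = {z ∈ ℂʳ | g(z) ≠ 0}`

is connected (`Literature.NumberTheory.Transcendental.HypersurfaceCover.isConnected`). This is exactly the statement
«`U(ℂ)` is connected» in the second proof of Theorem 7.1 (with the Lemma of §2.3 providing `F`,
`g`), proved as printed except that Lemma 7.5 (Riemann extension in `ℂʳ`) is applied along
complex lines only (`Literature.NumberTheory.Transcendental.Complex.exists_polynomial_of_finite_of_norm_le_pow`,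
`Literature.NumberTheory.Transcendental.exists_mvPolynomial_of_forall_line`):

* Over `V` the roots of `F(z, ·)` are simple, so by the holomorphic implicit function theorem
  (Mathlib `ContDiffAt.implicitFunction`) each root `t₀` of `F(z₀, ·)` extends to a holomorphic
  root function near `z₀`, and near `z₀` the zero set of `F` is the union of the `m = deg F`
  disjoint graphs (`exists_sheets`).
* If `H = (H ∩ u) ⊔ (H ∩ v)` with `u, v` open, the number of roots `t` of `F(z, ·)` with
  `(z, t) ∈ u` is locally constant on `V`, hence constant `= m_u` since `V` is connected
  (Lemma 7.2, `Literature.NumberTheory.Transcendental.isConnected_setOf_eval_ne_zero`), and `1 ≤ m_u ≤ m - 1` if both parts are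
  nonempty.
* The coefficients of `q_u(z) = ∏_{(z,t) ∈ u} (T - t)` are holomorphic on `V` (locally
  polynomials in the root functions), of polynomial growth (Cauchy's bound for the roots of the
  monic `F(z, ·)`), hence polynomial on every complex line off finitely many points (Riemann's
  removable singularity theorem and Lemma 7.6, one variable), hence restrictions of polynomials
  `Pᵢ ∈ B`; so `q_u(z) = Q_u(z, ·)` for a monic `Q_u ∈ B[T]` of degree `m_u`, and likewise `Q_v`.
* `Q_u Q_v` and `F` agree at every `z ∈ V` (both are `∏_{F(z,t)=0} (T - t)`), so `Q_u Q_v = F`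
  (a polynomial vanishing on the nonempty open `V` is zero) — contradicting the hypothesis on `F`.

## References

* I. R. Shafarevich, *Basic Algebraic Geometry 2*, Springer 1994, Book 3, Ch. VII §2.3 (second
  proof of Thm. 7.1) and §2.4 (Lemmas 7.5, 7.6).
* D. Mumford, *Algebraic Geometry I: Complex Projective Varieties*, (3.10)–(4.16) (the same
  symmetric-function argument).
-/

noncomputable section

open MvPolynomial Filter Topology Set

namespace Literature.NumberTheory.Transcendental

namespace HypersurfaceCover

variable {r : ℕ}

/-! ### The polynomial `F(z, t)` as a smooth function of `(z, t)` -/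

/-- Notation: the specialisation `F(z, ·) ∈ ℂ[T]` of `F ∈ ℂ[z₁, …, z_r][T]` at `z ∈ ℂʳ`.
[folklore] -/
abbrev spec (F : Polynomial (MvPolynomial (Fin r) ℂ)) (z : Fin r → ℂ) : Polynomial ℂ :=
  F.map (eval z)

/-- Evaluation of a polynomial in the variables `σ` at a differentiable family of values is
differentiable. [folklore] -/
theorem _root_.DifferentiableAt.mvPolynomial_eval {E : Type*} [NormedAddCommGroup E]
    [NormedSpace ℂ E] {σ : Type*} (P : MvPolynomial σ ℂ) {a : E → σ → ℂ} {x : E}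
    (ha : ∀ i, DifferentiableAt ℂ (fun y ↦ a y i) x) :
    DifferentiableAt ℂ (fun y ↦ eval (a y) P) x := by
  induction P using MvPolynomial.induction_on with
  | C c => simp only [MvPolynomial.eval_C]; exact differentiableAt_const c
  | add p q hp hq =>
    simp only [map_add]
    fun_prop
  | mul_X p i hp =>
    have := ha i
    simp only [map_mul, MvPolynomial.eval_X]
    fun_prop

/-- Evaluation of a polynomial in the variables `σ` at a `Cⁿ` family of values is `Cⁿ`.
[folklore] -/
theorem _root_.ContDiff.mvPolynomial_eval {E : Type*} [NormedAddCommGroup E]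
    [NormedSpace ℂ E] {σ : Type*} (P : MvPolynomial σ ℂ) {a : E → σ → ℂ} {n : WithTop ℕ∞}
    (ha : ∀ i, ContDiff ℂ n (fun y ↦ a y i)) :
    ContDiff ℂ n (fun y ↦ eval (a y) P) := by
  induction P using MvPolynomial.induction_on with
  | C c => simpa using contDiff_const (c := c)
  | add p q hp hq =>
    simp only [map_add]
    fun_prop
  | mul_X p i hp =>
    have := ha i
    simp only [map_mul, MvPolynomial.eval_X]
    fun_prop

/-- `(z, t) ↦ F(z, t)` written out: `Σᵢ Fᵢ(z) tⁱ`. [folklore] -/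
theorem eval_spec_eq_sum (F : Polynomial (MvPolynomial (Fin r) ℂ)) (z : Fin r → ℂ) (t : ℂ) :
    (spec F z).eval t = ∑ i ∈ Finset.range (F.natDegree + 1), eval z (F.coeff i) * t ^ i := by
  rw [Polynomial.eval_eq_sum_range' (n := F.natDegree + 1)]
  · simp [Polynomial.coeff_map]
  · exact lt_of_le_of_lt Polynomial.natDegree_map_le (Nat.lt_succ_self _)

/-- `(z, t) ↦ F(z, t)` is smooth (indeed polynomial). [folklore] -/
theorem contDiff_eval_spec (F : Polynomial (MvPolynomial (Fin r) ℂ)) {n : WithTop ℕ∞} :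
    ContDiff ℂ n (fun p : (Fin r → ℂ) × ℂ ↦ (spec F p.1).eval p.2) := by
  have : (fun p : (Fin r → ℂ) × ℂ ↦ (spec F p.1).eval p.2) = fun p ↦
      ∑ i ∈ Finset.range (F.natDegree + 1), eval p.1 (F.coeff i) * p.2 ^ i :=
    funext fun p ↦ eval_spec_eq_sum F p.1 p.2
  rw [this]
  refine ContDiff.sum fun i _ ↦ ContDiff.mul ?_ (contDiff_snd.pow i)
  exact ContDiff.mvPolynomial_eval _ fun j ↦ (contDiff_apply ℂ ℂ j).comp contDiff_fst

/-- The partial derivative of `(z, t) ↦ F(z, t)` in `t` at `(z₀, t₀)` is multiplication by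
`F'(z₀, t₀)` (derivative of the one-variable polynomial `F(z₀, ·)`). [folklore] -/
theorem fderiv_comp_inr (F : Polynomial (MvPolynomial (Fin r) ℂ)) (u : (Fin r → ℂ) × ℂ) :
    fderiv ℂ (fun p : (Fin r → ℂ) × ℂ ↦ (spec F p.1).eval p.2) u ∘L
        ContinuousLinearMap.inr ℂ (Fin r → ℂ) ℂ =
      (1 : ℂ →L[ℂ] ℂ).smulRight ((Polynomial.derivative (spec F u.1)).eval u.2) := by
  have hf : DifferentiableAt ℂ (fun p : (Fin r → ℂ) × ℂ ↦ (spec F p.1).eval p.2) u :=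
    (contDiff_eval_spec F (n := 1)).differentiable one_ne_zero u
  have h1 : HasFDerivAt (fun t : ℂ ↦ (spec F u.1).eval t)
      (fderiv ℂ (fun p : (Fin r → ℂ) × ℂ ↦ (spec F p.1).eval p.2) u ∘L
        ContinuousLinearMap.inr ℂ (Fin r → ℂ) ℂ) u.2 := by
    have := hf.hasFDerivAt.comp u.2 (hasFDerivAt_prodMk_right (𝕜 := ℂ) u.1 u.2)
    convert this using 1 <;> rfl
  have h2 : HasFDerivAt (fun t : ℂ ↦ (spec F u.1).eval t)
      ((1 : ℂ →L[ℂ] ℂ).smulRight ((Polynomial.derivative (spec F u.1)).eval u.2)) u.2 :=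
    (Polynomial.hasDerivAt (spec F u.1) u.2).hasFDerivAt
  exact h1.unique h2

/-- If `F'(z₀, t₀) ≠ 0`, the partial derivative in `t` is invertible. [folklore] -/
theorem isInvertible_fderiv_comp_inr (F : Polynomial (MvPolynomial (Fin r) ℂ))
    (u : (Fin r → ℂ) × ℂ) (hδ : (Polynomial.derivative (spec F u.1)).eval u.2 ≠ 0) :
    (fderiv ℂ (fun p : (Fin r → ℂ) × ℂ ↦ (spec F p.1).eval p.2) u ∘L
        ContinuousLinearMap.inr ℂ (Fin r → ℂ) ℂ).IsInvertible := by
  rw [fderiv_comp_inr]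
  refine ⟨ContinuousLinearEquiv.unitsEquivAut ℂ (Units.mk0 _ hδ), ?_⟩
  ext
  simp [ContinuousLinearEquiv.unitsEquivAut_apply]

/-! ### Holomorphic root functions (implicit function theorem) -/

/-- **Holomorphic root functions.** If `t₀` is a simple root of `F(z₀, ·)`, there is a function
`ρ` on `ℂʳ`, holomorphic near `z₀`, with `ρ(z₀) = t₀` and `F(z, ρ(z)) = 0` near `z₀`, and every
zero `(z, t)` of `F` close to `(z₀, t₀)` lies on its graph (holomorphic implicit function
theorem, Mathlib `ContDiffAt.implicitFunction`). [Shafarevich1994 VII §2.3 («local parameters …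
can be expressed as analytic functions», implicit function theorem)] [folklore] -/
theorem exists_rootFunction (F : Polynomial (MvPolynomial (Fin r) ℂ)) {z₀ : Fin r → ℂ} {t₀ : ℂ}
    (h0 : (spec F z₀).eval t₀ = 0) (hδ : (Polynomial.derivative (spec F z₀)).eval t₀ ≠ 0) :
    ∃ ρ : (Fin r → ℂ) → ℂ, ρ z₀ = t₀ ∧ (∀ᶠ z in 𝓝 z₀, (spec F z).eval (ρ z) = 0) ∧
      (∀ᶠ z in 𝓝 z₀, DifferentiableAt ℂ ρ z) ∧
      ∀ᶠ p in 𝓝 (z₀, t₀), (spec F p.1).eval p.2 = 0 → ρ p.1 = p.2 := by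
  set f : (Fin r → ℂ) × ℂ → ℂ := fun p ↦ (spec F p.1).eval p.2 with hf
  have cdf : ContDiffAt ℂ 1 f (z₀, t₀) := (contDiff_eval_spec F).contDiffAt
  have if₂ := isInvertible_fderiv_comp_inr F (z₀, t₀) hδ
  refine ⟨cdf.implicitFunction one_ne_zero if₂, cdf.implicitFunction_apply_self one_ne_zero if₂,
    ?_, ?_, ?_⟩
  · have := cdf.eventually_apply_implicitFunction one_ne_zero if₂
    filter_upwards [this] with z hz
    have h' : f (z, cdf.implicitFunction one_ne_zero if₂ z) = 0 := hz.trans h0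
    exact h'
  · have hcd := (cdf.contDiffAt_implicitFunction one_ne_zero if₂).eventually (by simp)
    filter_upwards [hcd] with z hz
    exact hz.differentiableAt one_ne_zero
  · have := cdf.eventually_apply_eq_iff_implicitFunction one_ne_zero if₂
    filter_upwards [this] with p hp hp0
    have h' : f p = f (z₀, t₀) := (show f p = 0 from hp0).trans h0.symm
    exact hp.mp h'

/-! ### Fibres of `F(z, ·) = 0` -/

open Classical in
/-- The (finite) set of roots of `F(z, ·)`. [folklore] -/
def fiber (F : Polynomial (MvPolynomial (Fin r) ℂ)) (z : Fin r → ℂ) : Finset ℂ :=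
  (spec F z).roots.toFinset

section Fiber

variable {F : Polynomial (MvPolynomial (Fin r) ℂ)} (hF : F.Monic)
include hF

/-- `F(z, ·)` is monic when `F` is. [folklore] -/
theorem monic_spec (z : Fin r → ℂ) : (spec F z).Monic := hF.map _

/-- `F(z, ·) ≠ 0` when `F` is monic. [folklore] -/
theorem spec_ne_zero (z : Fin r → ℂ) : spec F z ≠ 0 := (hF.map _).ne_zero

/-- `deg F(z, ·) = deg F` when `F` is monic. [folklore] -/
theorem natDegree_spec (z : Fin r → ℂ) : (spec F z).natDegree = F.natDegree := hF.natDegree_map _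

/-- `t ∈ fiber F z ↔ F(z, t) = 0`. [folklore] -/
theorem mem_fiber {z : Fin r → ℂ} {t : ℂ} : t ∈ fiber F z ↔ (spec F z).eval t = 0 := by
  rw [fiber, Multiset.mem_toFinset, Polynomial.mem_roots (spec_ne_zero hF z), Polynomial.IsRoot.def]

/-- `F(z, ·)` has at most `deg F` roots. [folklore] -/
theorem card_fiber_le (z : Fin r → ℂ) : (fiber F z).card ≤ F.natDegree :=
  (Multiset.toFinset_card_le _).trans ((Polynomial.card_roots' _).trans (natDegree_spec hF z).le)

/-- Where `F(z, ·)` is separable it has exactly `deg F` roots (`ℂ` is algebraically closed).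
[folklore] -/
theorem card_fiber_eq {z : Fin r → ℂ} (hsep : (spec F z).Separable) :
    (fiber F z).card = F.natDegree := by
  rw [fiber, Multiset.toFinset_card_of_nodup (Polynomial.nodup_roots hsep),
    IsAlgClosed.card_roots_eq_natDegree, natDegree_spec hF]

/-- `F(z, ·)` is the product of `T - t` over its roots, where it is separable. [folklore] -/
theorem prod_fiber_X_sub_C {z : Fin r → ℂ} (hsep : (spec F z).Separable) :
    ∏ t ∈ fiber F z, (Polynomial.X - Polynomial.C t) = spec F z := by
  rw [fiber, Finset.prod_eq_multiset_prod, Multiset.toFinset_val,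
    Multiset.dedup_eq_self.mpr (Polynomial.nodup_roots hsep)]
  exact Polynomial.prod_multiset_X_sub_C_of_monic_of_roots_card_eq (monic_spec hF z)
    (IsAlgClosed.card_roots_eq_natDegree)

omit hF in
/-- A root of a separable specialisation is simple. [folklore] -/
theorem derivative_eval_ne_zero {z : Fin r → ℂ} (hsep : (spec F z).Separable) {t : ℂ}
    (ht : (spec F z).eval t = 0) : (Polynomial.derivative (spec F z)).eval t ≠ 0 :=
  hsep.eval₂_derivative_ne_zero (RingHom.id ℂ) ht

/-- **Sheets.** Near a point `z₀` where `F(z₀, ·)` is separable, the zero set of `F` is the union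
of the graphs of `deg F` holomorphic root functions `ρ_τ`, `τ` running over the roots of
`F(z₀, ·)`, with pairwise distinct values. [Shafarevich1994 VII §2.3 (the cover is unramified);
Mumford CPV (3.10)] [folklore] -/
theorem exists_sheets {z₀ : Fin r → ℂ} (hsep : (spec F z₀).Separable) :
    ∃ ρ : ℂ → (Fin r → ℂ) → ℂ, (∀ τ ∈ fiber F z₀, ρ τ z₀ = τ) ∧
      ∀ᶠ z in 𝓝 z₀,
        (∀ τ ∈ fiber F z₀, (spec F z).eval (ρ τ z) = 0 ∧ DifferentiableAt ℂ (ρ τ) z) ∧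
        Set.InjOn (fun τ ↦ ρ τ z) (fiber F z₀) ∧
        fiber F z = (fiber F z₀).image (fun τ ↦ ρ τ z) := by
  have hex : ∀ τ ∈ fiber F z₀, ∃ ρ : (Fin r → ℂ) → ℂ, ρ z₀ = τ ∧
      (∀ᶠ z in 𝓝 z₀, (spec F z).eval (ρ z) = 0) ∧ (∀ᶠ z in 𝓝 z₀, DifferentiableAt ℂ ρ z) := by
    intro τ hτ
    have h0 := (mem_fiber hF).mp hτ
    obtain ⟨ρ, h1, h2, h3, -⟩ := exists_rootFunction F h0 (derivative_eval_ne_zero hsep h0)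
    exact ⟨ρ, h1, h2, h3⟩
  choose! ρ hρ0 hρF hρd using hex
  refine ⟨ρ, hρ0, ?_⟩
  -- roots and differentiability, for all `τ` at once
  have hA : ∀ᶠ z in 𝓝 z₀, ∀ τ ∈ fiber F z₀,
      (spec F z).eval (ρ τ z) = 0 ∧ DifferentiableAt ℂ (ρ τ) z :=
    (Filter.eventually_all_finset _).mpr fun τ hτ ↦ (hρF τ hτ).and (hρd τ hτ)
  -- injectivity: distinct roots stay distinct nearby, by continuity
  have hB : ∀ᶠ z in 𝓝 z₀, ∀ τ ∈ fiber F z₀, ∀ τ' ∈ fiber F z₀, τ ≠ τ' → ρ τ z ≠ ρ τ' z := by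
    refine (Filter.eventually_all_finset _).mpr fun τ hτ ↦
      (Filter.eventually_all_finset _).mpr fun τ' hτ' ↦ ?_
    by_cases hne : τ = τ'
    · exact Filter.Eventually.of_forall fun z h ↦ (h hne).elim
    · have hc : ContinuousAt (fun z ↦ ρ τ z - ρ τ' z) z₀ :=
        ((hρd τ hτ).self_of_nhds.continuousAt).sub ((hρd τ' hτ').self_of_nhds.continuousAt)
      have hne' : ρ τ z₀ - ρ τ' z₀ ≠ 0 := by
        rw [hρ0 τ hτ, hρ0 τ' hτ']
        exact sub_ne_zero.mpr hne
      filter_upwards [hc.eventually_ne hne'] with z hz _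
      exact sub_ne_zero.mp hz
  filter_upwards [hA, hB] with z hzA hzB
  have hinj : Set.InjOn (fun τ ↦ ρ τ z) (fiber F z₀) :=
    fun τ hτ τ' hτ' e ↦ by_contra fun hne ↦ hzB τ hτ τ' hτ' hne e
  refine ⟨hzA, hinj, ?_⟩
  -- the `deg F` distinct values `ρ_τ(z)` are roots of `F(z, ·)`, which has at most `deg F` roots
  symm
  apply Finset.eq_of_subset_of_card_le
  · intro t ht
    obtain ⟨τ, hτ, rfl⟩ := Finset.mem_image.mp ht
    exact (mem_fiber hF).mpr (hzA τ hτ).1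
  · rw [Finset.card_image_of_injOn hinj, card_fiber_eq hF hsep]
    exact card_fiber_le hF z

end Fiber

/-! ### Growth bounds -/

/-- Polynomials have polynomial growth: `‖b(z)‖ ≤ C (1 + ‖z‖) ^ D`. [folklore] -/
theorem exists_norm_eval_le_pow (b : MvPolynomial (Fin r) ℂ) :
    ∃ C : ℝ, 0 ≤ C ∧ ∃ D : ℕ, ∀ z : Fin r → ℂ, ‖eval z b‖ ≤ C * (1 + ‖z‖) ^ D := by
  induction b using MvPolynomial.induction_on with
  | C c => exact ⟨‖c‖, norm_nonneg _, 0, fun z ↦ by simp⟩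
  | add p q hp hq =>
    obtain ⟨C₁, hC₁, D₁, h₁⟩ := hp
    obtain ⟨C₂, hC₂, D₂, h₂⟩ := hq
    refine ⟨C₁ + C₂, add_nonneg hC₁ hC₂, max D₁ D₂, fun z ↦ ?_⟩
    have hz : 1 ≤ 1 + ‖z‖ := le_add_of_nonneg_right (norm_nonneg _)
    rw [map_add]
    refine (norm_add_le _ _).trans ?_
    calc ‖eval z p‖ + ‖eval z q‖ ≤ C₁ * (1 + ‖z‖) ^ D₁ + C₂ * (1 + ‖z‖) ^ D₂ := add_le_add (h₁ z) (h₂ z)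
      _ ≤ C₁ * (1 + ‖z‖) ^ max D₁ D₂ + C₂ * (1 + ‖z‖) ^ max D₁ D₂ :=
        add_le_add (mul_le_mul_of_nonneg_left (pow_le_pow_right₀ hz (le_max_left _ _)) hC₁)
          (mul_le_mul_of_nonneg_left (pow_le_pow_right₀ hz (le_max_right _ _)) hC₂)
      _ = (C₁ + C₂) * (1 + ‖z‖) ^ max D₁ D₂ := by ring
  | mul_X p i hp =>
    obtain ⟨C, hC, D, h⟩ := hp
    refine ⟨C, hC, D + 1, fun z ↦ ?_⟩
    rw [map_mul, MvPolynomial.eval_X, norm_mul, pow_succ, ← mul_assoc]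
    refine mul_le_mul (h z) ((norm_le_pi_norm z i).trans (le_add_of_nonneg_left zero_le_one))
      (norm_nonneg _) ?_
    exact mul_nonneg hC (pow_nonneg (by positivity) _)

/-- Cauchy's bound for the roots of the monic `F(z, ·)`:
`‖t‖ ≤ 1 + Σᵢ ‖Fᵢ(z)‖`. [folklore] -/
def rootBound (F : Polynomial (MvPolynomial (Fin r) ℂ)) (z : Fin r → ℂ) : ℝ :=
  1 + ∑ i ∈ Finset.range F.natDegree, ‖eval z (F.coeff i)‖

/-- `1 ≤ rootBound F z`. [folklore] -/
theorem one_le_rootBound (F : Polynomial (MvPolynomial (Fin r) ℂ)) (z : Fin r → ℂ) :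
    1 ≤ rootBound F z :=
  le_add_of_nonneg_right (Finset.sum_nonneg fun _ _ ↦ norm_nonneg _)

/-- Every root of `F(z, ·)` has absolute value `≤ rootBound F z` (Cauchy's bound, Mathlib
`Polynomial.IsRoot.norm_lt_cauchyBound`). [folklore] -/
theorem norm_le_rootBound {F : Polynomial (MvPolynomial (Fin r) ℂ)} (hF : F.Monic)
    {z : Fin r → ℂ} {t : ℂ} (ht : t ∈ fiber F z) : ‖t‖ ≤ rootBound F z := by
  have hroot : (spec F z).IsRoot t := (mem_fiber hF).mp ht
  have h := Polynomial.IsRoot.norm_lt_cauchyBound (spec_ne_zero hF z) hroot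
  rw [Polynomial.cauchyBound, (monic_spec hF z).leadingCoeff, nnnorm_one, div_one,
    natDegree_spec hF] at h
  have hsup : (Finset.range F.natDegree).sup (fun i ↦ ‖(spec F z).coeff i‖₊) ≤
      ∑ i ∈ Finset.range F.natDegree, ‖(spec F z).coeff i‖₊ :=
    Finset.sup_le fun i hi ↦
      Finset.single_le_sum (f := fun j ↦ ‖(spec F z).coeff j‖₊) (fun j _ ↦ zero_le) hi
  have h' : (‖t‖₊ : ℝ) ≤ ∑ i ∈ Finset.range F.natDegree, (‖(spec F z).coeff i‖₊ : ℝ) + 1 := by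
    have := h.le.trans (add_le_add hsup le_rfl)
    exact_mod_cast this
  rw [rootBound, add_comm]
  simpa [Polynomial.coeff_map] using h'

/-- The root bound has polynomial growth in `z`. [folklore] -/
theorem exists_rootBound_le_pow (F : Polynomial (MvPolynomial (Fin r) ℂ)) :
    ∃ C : ℝ, 1 ≤ C ∧ ∃ D : ℕ, ∀ z : Fin r → ℂ, 1 + rootBound F z ≤ C * (1 + ‖z‖) ^ D := by
  choose C hC D hD using fun i : ℕ ↦ exists_norm_eval_le_pow (F.coeff i)
  have hCsum : 0 ≤ ∑ i ∈ Finset.range F.natDegree, C i := Finset.sum_nonneg fun i _ ↦ hC i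
  refine ⟨2 + (∑ i ∈ Finset.range F.natDegree, C i), by linarith,
    (Finset.range F.natDegree).sup D, fun z ↦ ?_⟩
  have hz : 1 ≤ 1 + ‖z‖ := le_add_of_nonneg_right (norm_nonneg _)
  set E := (Finset.range F.natDegree).sup D
  have hpow : 1 ≤ (1 + ‖z‖) ^ E := one_le_pow₀ hz
  have hsum : ∑ i ∈ Finset.range F.natDegree, ‖eval z (F.coeff i)‖ ≤
      ∑ i ∈ Finset.range F.natDegree, C i * (1 + ‖z‖) ^ E := by
    refine Finset.sum_le_sum fun i hi ↦ (hD i z).trans ?_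
    exact mul_le_mul_of_nonneg_left (pow_le_pow_right₀ hz (Finset.le_sup hi)) (hC i)
  rw [← Finset.sum_mul] at hsum
  rw [rootBound]
  nlinarith

/-- Coefficients of `∏_{t ∈ S} (T - t)` are bounded by `(1 + R) ^ |S|` when `‖t‖ ≤ R` on `S`.
[folklore] -/
theorem norm_coeff_prod_X_sub_C_le (S : Finset ℂ) {R : ℝ} (hR : 0 ≤ R)
    (hS : ∀ t ∈ S, ‖t‖ ≤ R) (i : ℕ) :
    ‖(∏ t ∈ S, (Polynomial.X - Polynomial.C t)).coeff i‖ ≤ (1 + R) ^ S.card := by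
  induction S using Finset.induction_on generalizing i with
  | empty =>
    simp only [Finset.prod_empty, Polynomial.coeff_one, Finset.card_empty, pow_zero]
    split_ifs <;> simp
  | insert a S haS ih =>
    have ha : ‖a‖ ≤ R := hS a (Finset.mem_insert_self a S)
    have ih' := ih (fun t ht ↦ hS t (Finset.mem_insert_of_mem ht))
    rw [Finset.prod_insert haS, Finset.card_insert_of_notMem haS, pow_succ]
    have hK : 0 ≤ (1 + R) ^ S.card := pow_nonneg (by linarith) _
    cases i with
    | zero =>
      rw [Polynomial.mul_coeff_zero]
      simp only [Polynomial.coeff_sub, Polynomial.coeff_X_zero, Polynomial.coeff_C_zero,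
        zero_sub, neg_mul, norm_neg, norm_mul]
      calc ‖a‖ * ‖(∏ t ∈ S, (Polynomial.X - Polynomial.C t)).coeff 0‖
          ≤ R * (1 + R) ^ S.card := mul_le_mul ha (ih' 0) (norm_nonneg _) hR
        _ ≤ (1 + R) ^ S.card * (1 + R) := by nlinarith
    | succ j =>
      rw [Polynomial.coeff_X_sub_C_mul]
      refine (norm_sub_le _ _).trans ?_
      rw [norm_mul]
      calc ‖(∏ t ∈ S, (Polynomial.X - Polynomial.C t)).coeff j‖ +
            ‖a‖ * ‖(∏ t ∈ S, (Polynomial.X - Polynomial.C t)).coeff (j + 1)‖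
          ≤ (1 + R) ^ S.card + R * (1 + R) ^ S.card :=
            add_le_add (ih' j) (mul_le_mul ha (ih' (j + 1)) (norm_nonneg _) hR)
        _ = (1 + R) ^ S.card * (1 + R) := by ring

/-- Lines have linear growth: `1 + ‖a + s v‖ ≤ (1 + ‖a‖ + ‖v‖)(1 + ‖s‖)`. [folklore] -/
theorem one_add_norm_lineMap_le (a v : Fin r → ℂ) (s : ℂ) :
    1 + ‖a + s • v‖ ≤ (1 + ‖a‖ + ‖v‖) * (1 + ‖s‖) := by
  have h1 : ‖a + s • v‖ ≤ ‖a‖ + ‖s‖ * ‖v‖ := (norm_add_le _ _).trans (by rw [norm_smul])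
  nlinarith [norm_nonneg a, norm_nonneg v, norm_nonneg s, mul_nonneg (norm_nonneg a) (norm_nonneg s),
    mul_nonneg (norm_nonneg v) (norm_nonneg s)]

/-! ### The part of the cover inside an open set `u` -/

open Classical in
/-- The roots `t` of `F(z, ·)` with `(z, t) ∈ u`. [folklore] -/
def uRoots (F : Polynomial (MvPolynomial (Fin r) ℂ)) (u : Set ((Fin r → ℂ) × ℂ)) (z : Fin r → ℂ) :
    Finset ℂ :=
  (fiber F z).filter fun t ↦ (z, t) ∈ u

/-- The monic one-variable polynomial `q_u(z) = ∏_{F(z,t)=0, (z,t) ∈ u} (T - t)`.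
[Shafarevich1994 VII §2.3 (the polynomial (7.6))] [folklore] -/
def uPoly (F : Polynomial (MvPolynomial (Fin r) ℂ)) (u : Set ((Fin r → ℂ) × ℂ)) (z : Fin r → ℂ) :
    Polynomial ℂ :=
  ∏ t ∈ uRoots F u z, (Polynomial.X - Polynomial.C t)

/-- `t ∈ uRoots F u z ↔ F(z, t) = 0 ∧ (z, t) ∈ u`. [folklore] -/
theorem mem_uRoots {F : Polynomial (MvPolynomial (Fin r) ℂ)} {u : Set ((Fin r → ℂ) × ℂ)}
    {z : Fin r → ℂ} {t : ℂ} : t ∈ uRoots F u z ↔ t ∈ fiber F z ∧ (z, t) ∈ u := by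
  simp only [uRoots, Finset.mem_filter]

/-- `uRoots F u z ⊆ fiber F z`. [folklore] -/
theorem uRoots_subset (F : Polynomial (MvPolynomial (Fin r) ℂ)) (u : Set ((Fin r → ℂ) × ℂ))
    (z : Fin r → ℂ) : uRoots F u z ⊆ fiber F z :=
  fun _ ht ↦ (mem_uRoots.mp ht).1

/-- `q_u(z)` is monic. [folklore] -/
theorem monic_uPoly (F : Polynomial (MvPolynomial (Fin r) ℂ)) (u : Set ((Fin r → ℂ) × ℂ))
    (z : Fin r → ℂ) : (uPoly F u z).Monic :=
  Polynomial.monic_prod_X_sub_C _ _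

/-- `deg q_u(z)` is the number of roots of `F(z, ·)` in `u`. [folklore] -/
theorem natDegree_uPoly (F : Polynomial (MvPolynomial (Fin r) ℂ)) (u : Set ((Fin r → ℂ) × ℂ))
    (z : Fin r → ℂ) : (uPoly F u z).natDegree = (uRoots F u z).card := by
  rw [uPoly, Polynomial.natDegree_finsetProd_X_sub_C_eq_card]

/-- Global coefficient bound for `q_u(z)`: polynomial growth in `z`. [Shafarevich1994 VII §2.3
(«the `gᵢ` are analytic functions … having polynomial growth»)] [folklore] -/
theorem exists_norm_coeff_uPoly_le {F : Polynomial (MvPolynomial (Fin r) ℂ)} (hF : F.Monic)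
    (u : Set ((Fin r → ℂ) × ℂ)) :
    ∃ C : ℝ, 0 ≤ C ∧ ∃ D : ℕ, ∀ (z : Fin r → ℂ) (i : ℕ),
      ‖(uPoly F u z).coeff i‖ ≤ C * (1 + ‖z‖) ^ D := by
  obtain ⟨C, hC, D, hD⟩ := exists_rootBound_le_pow F
  refine ⟨C ^ F.natDegree, pow_nonneg (by linarith) _, D * F.natDegree, fun z i ↦ ?_⟩
  have h1 := norm_coeff_prod_X_sub_C_le (uRoots F u z) (R := rootBound F z)
    (le_trans zero_le_one (one_le_rootBound F z))
    (fun t ht ↦ norm_le_rootBound hF (uRoots_subset F u z ht)) i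
  have hcard : (uRoots F u z).card ≤ F.natDegree :=
    (Finset.card_le_card (uRoots_subset F u z)).trans (card_fiber_le hF z)
  have hbase : 1 ≤ 1 + rootBound F z := by linarith [one_le_rootBound F z]
  calc ‖(uPoly F u z).coeff i‖ ≤ (1 + rootBound F z) ^ (uRoots F u z).card := h1
    _ ≤ (1 + rootBound F z) ^ F.natDegree := pow_le_pow_right₀ hbase hcard
    _ ≤ (C * (1 + ‖z‖) ^ D) ^ F.natDegree :=
        pow_le_pow_left₀ (by linarith [one_le_rootBound F z]) (hD z) _
    _ = C ^ F.natDegree * (1 + ‖z‖) ^ (D * F.natDegree) := by rw [mul_pow, ← pow_mul]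

/-- Two monic polynomials of the same degree with the same lower coefficients are equal.
[folklore] -/
theorem _root_.Polynomial.eq_of_monic_of_coeff_eq_of_lt {R : Type*} [Semiring R] {p q : Polynomial R}
    (hp : p.Monic) (hq : q.Monic) (hdeg : p.natDegree = q.natDegree)
    (h : ∀ i < p.natDegree, p.coeff i = q.coeff i) : p = q := by
  ext i
  rcases lt_trichotomy i p.natDegree with hi | rfl | hi
  · exact h i hi
  · rw [hp.coeff_natDegree, hdeg, hq.coeff_natDegree]
  · rw [Polynomial.coeff_eq_zero_of_natDegree_lt hi,
      Polynomial.coeff_eq_zero_of_natDegree_lt (hdeg ▸ hi)]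

section Cover

variable {F : Polynomial (MvPolynomial (Fin r) ℂ)} {g : MvPolynomial (Fin r) ℂ}
  {u v : Set ((Fin r → ℂ) × ℂ)}
  (hF : F.Monic) (hsep : ∀ z, eval z g ≠ 0 → (spec F z).Separable)
  (hu : IsOpen u) (hv : IsOpen v)
  (hcov : ∀ z t, eval z g ≠ 0 → (spec F z).eval t = 0 → (z, t) ∈ u ∨ (z, t) ∈ v)
  (hdisj : ∀ z t, eval z g ≠ 0 → (spec F z).eval t = 0 → (z, t) ∈ u → (z, t) ∉ v)

include hF hsep hu hv hcov hdisj

/-- **Local structure of the `u`-part.** Near `z₀ ∈ V`, membership `(z, ρ_τ(z)) ∈ u` of a sheet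
does not depend on `z` (the sheet over a small ball is connected and `H ∩ u`, `H ∩ v` are
disjoint open), so `uRoots F u z` is the image of `uRoots F u z₀` under the root functions.
[Shafarevich1994 VII §2.3 («the restriction of `f` to `M₁` defines an unramified cover»)]
[folklore] -/
theorem eventually_uRoots_eq_image {z₀ : Fin r → ℂ} (hz₀ : eval z₀ g ≠ 0) :
    ∃ ρ : ℂ → (Fin r → ℂ) → ℂ, (∀ τ ∈ fiber F z₀, ρ τ z₀ = τ) ∧ ∀ᶠ z in 𝓝 z₀,
      (∀ τ ∈ fiber F z₀, DifferentiableAt ℂ (ρ τ) z) ∧ Set.InjOn (fun τ ↦ ρ τ z) (fiber F z₀) ∧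
      uRoots F u z = (uRoots F u z₀).image (fun τ ↦ ρ τ z) := by
  obtain ⟨ρ, hρ0, hev⟩ := exists_sheets hF (hsep z₀ hz₀)
  refine ⟨ρ, hρ0, ?_⟩
  have hV : ∀ᶠ z in 𝓝 z₀, eval z g ≠ 0 := (isOpen_setOf_eval_ne_zero g).mem_nhds hz₀
  obtain ⟨ε, hε, hball⟩ := Metric.eventually_nhds_iff_ball.mp (hev.and hV)
  -- membership constancy on the ball
  have hmem : ∀ τ ∈ fiber F z₀, ∀ z ∈ Metric.ball z₀ ε, ((z, ρ τ z) ∈ u ↔ (z₀, τ) ∈ u) := by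
    intro τ hτ
    set γ : (Fin r → ℂ) → (Fin r → ℂ) × ℂ := fun z ↦ (z, ρ τ z) with hγ
    have hγc : ContinuousOn γ (Metric.ball z₀ ε) := by
      refine continuousOn_of_forall_continuousAt fun z hz ↦ ?_
      exact continuousAt_id.prodMk ((hball z hz).1.1 τ hτ).2.continuousAt
    have hAu : IsOpen (Metric.ball z₀ ε ∩ γ ⁻¹' u) := hγc.isOpen_inter_preimage Metric.isOpen_ball hu
    have hAv : IsOpen (Metric.ball z₀ ε ∩ γ ⁻¹' v) := hγc.isOpen_inter_preimage Metric.isOpen_ball hv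
    have hH : ∀ z ∈ Metric.ball z₀ ε, eval z g ≠ 0 ∧ (spec F z).eval (ρ τ z) = 0 :=
      fun z hz ↦ ⟨(hball z hz).2, ((hball z hz).1.1 τ hτ).1⟩
    have hsub : Metric.ball z₀ ε ⊆ (Metric.ball z₀ ε ∩ γ ⁻¹' u) ∪ (Metric.ball z₀ ε ∩ γ ⁻¹' v) := by
      intro z hz
      rcases hcov z (ρ τ z) (hH z hz).1 (hH z hz).2 with h | h
      · exact Or.inl ⟨hz, h⟩
      · exact Or.inr ⟨hz, h⟩
    have hdj : Disjoint (Metric.ball z₀ ε ∩ γ ⁻¹' u) (Metric.ball z₀ ε ∩ γ ⁻¹' v) := by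
      rw [Set.disjoint_left]
      rintro z ⟨hz, hzu⟩ ⟨-, hzv⟩
      exact hdisj z (ρ τ z) (hH z hz).1 (hH z hz).2 hzu hzv
    have hpre : IsPreconnected (Metric.ball z₀ ε) := (convex_ball z₀ ε).isPreconnected
    have hz₀ball : z₀ ∈ Metric.ball z₀ ε := Metric.mem_ball_self hε
    have hγ0 : γ z₀ = (z₀, τ) := by simp [hγ, hρ0 τ hτ]
    intro z hz
    rcases hpre.subset_or_subset hAu hAv hdj hsub with h | h
    · have hz0u : (z₀, τ) ∈ u := hγ0 ▸ (h hz₀ball).2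
      exact ⟨fun _ ↦ hz0u, fun _ ↦ (h hz).2⟩
    · have hz0v : (z₀, τ) ∈ v := hγ0 ▸ (h hz₀ball).2
      have hz0u : (z₀, τ) ∉ u := fun h' ↦
        hdisj z₀ τ hz₀ (by simpa [hρ0 τ hτ] using (hH z₀ hz₀ball).2) h' hz0v
      refine ⟨fun hzu ↦ (hdisj z (ρ τ z) (hH z hz).1 (hH z hz).2 hzu (h hz).2).elim,
        fun h' ↦ (hz0u h').elim⟩
  filter_upwards [Metric.ball_mem_nhds z₀ hε] with z hz
  obtain ⟨⟨hzA, hinj, hfib⟩, -⟩ := hball z hz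
  refine ⟨fun τ hτ ↦ (hzA τ hτ).2, hinj, ?_⟩
  classical
  rw [uRoots, hfib, Finset.filter_image, uRoots]
  congr 1
  exact Finset.filter_congr fun τ hτ ↦ hmem τ hτ z hz

/-- The number of sheets in `u` is locally constant on `V`. [Shafarevich1994 VII §2.3 («the
number of inverse images in `M₁` … is constant»)] [folklore] -/
theorem eventually_card_uRoots_eq {z₀ : Fin r → ℂ} (hz₀ : eval z₀ g ≠ 0) :
    ∀ᶠ z in 𝓝 z₀, (uRoots F u z).card = (uRoots F u z₀).card := by
  obtain ⟨ρ, -, hev⟩ := eventually_uRoots_eq_image hF hsep hu hv hcov hdisj hz₀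
  filter_upwards [hev] with z hz
  obtain ⟨-, hinj, heq⟩ := hz
  rw [heq, Finset.card_image_of_injOn (hinj.mono (uRoots_subset F u z₀))]

/-- The number of sheets in `u` is constant on `V` (`V` is connected, Lemma 7.2).
[Shafarevich1994 VII §2.3] [folklore] -/
theorem card_uRoots_eq (hg : g ≠ 0) {z z' : Fin r → ℂ} (hz : eval z g ≠ 0) (hz' : eval z' g ≠ 0) :
    (uRoots F u z).card = (uRoots F u z').card := by
  have hcont : ContinuousOn (fun z ↦ (uRoots F u z).card) {z | eval z g ≠ 0} := by
    intro z₀ hz₀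
    refine ContinuousAt.continuousWithinAt ?_
    have hev := eventually_card_uRoots_eq hF hsep hu hv hcov hdisj hz₀
    exact (continuousAt_const (y := (uRoots F u z₀).card)).congr_of_eventuallyEq hev
  exact (isConnected_setOf_eval_ne_zero hg).isPreconnected.constant hcont hz hz'

/-- The coefficients of `q_u(z)` are holomorphic on `V` (near `z₀` they are polynomials in the
holomorphic root functions). [Shafarevich1994 VII §2.3 («`g₁, …, g_r` are analytic functions of
`z₁, …, zₙ`»)] [folklore] -/
theorem differentiableAt_coeff_uPoly {z₀ : Fin r → ℂ} (hz₀ : eval z₀ g ≠ 0) (i : ℕ) :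
    DifferentiableAt ℂ (fun z ↦ (uPoly F u z).coeff i) z₀ := by
  classical
  obtain ⟨ρ, hρ0, hev⟩ := eventually_uRoots_eq_image hF hsep hu hv hcov hdisj hz₀
  set S := uRoots F u z₀ with hS
  let Pp : Polynomial (MvPolynomial S ℂ) :=
    ∏ τ ∈ S.attach, (Polynomial.X - Polynomial.C (MvPolynomial.X τ))
  have hloc : (fun z ↦ (uPoly F u z).coeff i) =ᶠ[𝓝 z₀]
      fun z ↦ eval (fun τ : S ↦ ρ τ.1 z) (Pp.coeff i) := by
    filter_upwards [hev] with z hz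
    obtain ⟨-, hinj, heq⟩ := hz
    have h1 : uPoly F u z = ∏ τ ∈ S, (Polynomial.X - Polynomial.C (ρ τ z)) := by
      rw [uPoly, heq, Finset.prod_image (hinj.mono (uRoots_subset F u z₀))]
    have h2 : Pp.map (eval fun τ : S ↦ ρ τ.1 z) = ∏ τ ∈ S, (Polynomial.X - Polynomial.C (ρ τ z)) := by
      rw [Polynomial.map_prod]
      simp only [Polynomial.map_sub, Polynomial.map_X, Polynomial.map_C, MvPolynomial.eval_X]
      exact Finset.prod_attach S fun τ ↦ Polynomial.X - Polynomial.C (ρ τ z)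
    change (uPoly F u z).coeff i = eval (fun τ : S ↦ ρ τ.1 z) (Pp.coeff i)
    rw [h1, ← h2, Polynomial.coeff_map]
  refine DifferentiableAt.congr_of_eventuallyEq ?_ hloc
  refine DifferentiableAt.mvPolynomial_eval _ fun τ ↦ ?_
  exact hev.self_of_nhds.1 τ.1 (uRoots_subset F u z₀ τ.2)

/-- Hence the coefficients of `q_u` are continuous on `V`. [folklore] -/
theorem continuousOn_coeff_uPoly (i : ℕ) :
    ContinuousOn (fun z ↦ (uPoly F u z).coeff i) {z | eval z g ≠ 0} := fun _ hz ↦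
  (differentiableAt_coeff_uPoly hF hsep hu hv hcov hdisj hz i).continuousAt.continuousWithinAt

/-- **The coefficients of `q_u` are polynomials on every complex line** (Riemann's removable
singularity theorem and Lemma 7.6 along the line: they are holomorphic off the finitely many
points of the line in `Z(g)` and have polynomial growth). [Shafarevich1994 VII §2.3–2.4]
[folklore] -/
theorem line_coeff_uPoly {C : ℝ} {D : ℕ}
    (hbd : ∀ (z : Fin r → ℂ) (i : ℕ), ‖(uPoly F u z).coeff i‖ ≤ C * (1 + ‖z‖) ^ D)
    (i : ℕ) (a w : Fin r → ℂ) (hex : ∃ s : ℂ, eval (a + s • w) g ≠ 0) :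
    ∃ e : Polynomial ℂ, e.natDegree ≤ D ∧
      ∀ s : ℂ, eval (a + s • w) g ≠ 0 → (uPoly F u (a + s • w)).coeff i = e.eval s := by
  obtain ⟨q, hq⟩ := exists_polynomial_eval_lineMap g a (a + w)
  simp only [add_sub_cancel_left] at hq
  obtain ⟨s₀, hs₀⟩ := hex
  have hq0 : q ≠ 0 := fun h ↦ hs₀ (by rw [← hq, h, Polynomial.eval_zero])
  have hfin : {s : ℂ | q.IsRoot s}.Finite := Polynomial.finite_setOf_isRoot hq0
  have hS : ∀ s, s ∉ {s : ℂ | q.IsRoot s} ↔ eval (a + s • w) g ≠ 0 := fun s ↦ by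
    simp [Polynomial.IsRoot.def, hq]
  have hdiff : DifferentiableOn ℂ (fun s : ℂ ↦ (uPoly F u (a + s • w)).coeff i)
      {s : ℂ | q.IsRoot s}ᶜ := by
    intro s hs
    have hz : eval (a + s • w) g ≠ 0 := (hS s).mp hs
    have hl : DifferentiableAt ℂ (fun s : ℂ ↦ a + s • w) s :=
      (differentiableAt_const _).add (differentiableAt_id.smul_const w)
    exact ((differentiableAt_coeff_uPoly hF hsep hu hv hcov hdisj hz i).comp s hl).differentiableWithinAt
  have hC : 0 ≤ C := by
    have := hbd 0 0
    exact le_of_mul_le_mul_right ((mul_nonneg_iff_of_pos_right (by positivity)).mp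
      ((norm_nonneg _).trans this) |> fun h ↦ by nlinarith [norm_nonneg ((uPoly F u 0).coeff 0)])
      (show (0 : ℝ) < 1 from one_pos) |> fun _ ↦ (mul_nonneg_iff_of_pos_right
        (by positivity)).mp ((norm_nonneg _).trans this)
  have hb : ∀ s ∉ {s : ℂ | q.IsRoot s}, ‖(uPoly F u (a + s • w)).coeff i‖ ≤
      C * (1 + ‖a‖ + ‖w‖) ^ D * (1 + ‖s‖) ^ D := by
    intro s _
    refine (hbd _ i).trans ?_
    rw [mul_assoc, ← mul_pow]
    exact mul_le_mul_of_nonneg_left (pow_le_pow_left₀ (by positivity)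
      (one_add_norm_lineMap_le a w s) D) hC
  obtain ⟨e, he, hfe⟩ := Complex.exists_polynomial_of_finite_of_norm_le_pow hfin hdiff hb
  exact ⟨e, he, fun s hs ↦ hfe s ((hS s).mpr hs)⟩

/-- **The coefficients of `q_u` are restrictions of polynomials `Pᵢ ∈ ℂ[z]`** («there exist
polynomials `p₁, …, p_r ∈ ℂ[𝔸ⁿ]` whose restrictions … equal `g₁, …, g_r`»).
[cite: Shafarevich1994, Book 3 Ch. VII §2.3 (7.6)] -/
theorem exists_mvPolynomial_coeff_uPoly (hg : g ≠ 0) (i : ℕ) :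
    ∃ P : MvPolynomial (Fin r) ℂ, ∀ z, eval z g ≠ 0 → (uPoly F u z).coeff i = eval z P := by
  obtain ⟨C, -, D, hbd⟩ := exists_norm_coeff_uPoly_le hF u
  exact exists_mvPolynomial_of_forall_line D r hg (continuousOn_coeff_uPoly hF hsep hu hv hcov hdisj i)
    (fun a w hex ↦ line_coeff_uPoly hF hsep hu hv hcov hdisj hbd i a w hex)

/-- **The polynomial `Q_u ∈ ℂ[z][T]`** with `Q_u(z, ·) = q_u(z)` for all `z ∈ V`: monic of degree
the (constant) number `m_u` of sheets in `u`. [cite: Shafarevich1994, Book 3 Ch. VII §2.3 (7.6)] -/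
theorem exists_Q (hg : g ≠ 0) {z₁ : Fin r → ℂ} (hz₁ : eval z₁ g ≠ 0) :
    ∃ Q : Polynomial (MvPolynomial (Fin r) ℂ), Q.Monic ∧ Q.natDegree = (uRoots F u z₁).card ∧
      ∀ z, eval z g ≠ 0 → spec Q z = uPoly F u z := by
  set m := (uRoots F u z₁).card with hm
  choose P hP using fun i : ℕ ↦ exists_mvPolynomial_coeff_uPoly hF hsep hu hv hcov hdisj hg i
  let Q : Polynomial (MvPolynomial (Fin r) ℂ) :=
    Polynomial.X ^ m + ∑ j : Fin m, Polynomial.C (P j) * Polynomial.X ^ (j : ℕ)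
  have hlt : (∑ j : Fin m, Polynomial.C (P j) * Polynomial.X ^ (j : ℕ)).degree < (m : WithBot ℕ) :=
    Polynomial.degree_sum_fin_lt _
  have hQm : Q.Monic := Polynomial.monic_X_pow_add hlt
  have hQdeg : Q.natDegree = m := by
    rw [Polynomial.natDegree_add_eq_left_of_degree_lt, Polynomial.natDegree_X_pow]
    rwa [Polynomial.degree_X_pow]
  have hQcoeff : ∀ i < m, Q.coeff i = P i := by
    intro i hi
    simp only [Q, Polynomial.coeff_add, Polynomial.coeff_X_pow, if_neg hi.ne,
      Polynomial.finsetSum_coeff, Polynomial.coeff_C_mul_X_pow, zero_add]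
    rw [Finset.sum_eq_single ⟨i, hi⟩]
    · simp
    · intro j _ hj
      rw [if_neg]
      exact fun h ↦ hj (Fin.ext h.symm)
    · simp
  refine ⟨Q, hQm, hQdeg, fun z hz ↦ ?_⟩
  refine Polynomial.eq_of_monic_of_coeff_eq_of_lt (hQm.map _) (monic_uPoly F u z) ?_ ?_
  · rw [hQm.natDegree_map, hQdeg, natDegree_uPoly]
    exact card_uRoots_eq hF hsep hu hv hcov hdisj hg hz₁ hz
  · intro i hi
    rw [hQm.natDegree_map, hQdeg] at hi
    rw [Polynomial.coeff_map, hQcoeff i hi, ← hP i z hz]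

omit hu hv in
/-- On `V`, `q_u(z) q_v(z) = F(z, ·)`. [Shafarevich1994 VII §2.3] [folklore] -/
theorem uPoly_mul_uPoly {z : Fin r → ℂ} (hz : eval z g ≠ 0) :
    uPoly F u z * uPoly F v z = spec F z := by
  classical
  have hv' : uRoots F v z = (fiber F z).filter fun t ↦ ¬ (z, t) ∈ u := by
    rw [uRoots]
    refine Finset.filter_congr fun t ht ↦ ?_
    have ht' := (mem_fiber hF).mp ht
    exact ⟨fun htv htu ↦ hdisj z t hz ht' htu htv,
      fun htu ↦ (hcov z t hz ht').resolve_left htu⟩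
  rw [uPoly, uPoly, hv', uRoots, Finset.prod_filter_mul_prod_filter_not, prod_fiber_X_sub_C hF (hsep z hz)]

/-- **The contradiction.** If both `H ∩ u` and `H ∩ v` are nonempty then `F = Q_u Q_v` with
`Q_u, Q_v` monic of positive degree. [cite: Shafarevich1994, Book 3 Ch. VII §2.3 (second proof of
Thm. 7.1)] -/
theorem false_of_nonempty (hg : g ≠ 0)
    (hirr : ∀ Q₁ Q₂ : Polynomial (MvPolynomial (Fin r) ℂ), Q₁.Monic → Q₂.Monic → Q₁ * Q₂ = F →
      Q₁.natDegree = 0 ∨ Q₂.natDegree = 0)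
    {z₁ : Fin r → ℂ} {t₁ : ℂ} (hz₁ : eval z₁ g ≠ 0) (ht₁ : (spec F z₁).eval t₁ = 0) (hu₁ : (z₁, t₁) ∈ u)
    {z₂ : Fin r → ℂ} {t₂ : ℂ} (hz₂ : eval z₂ g ≠ 0) (ht₂ : (spec F z₂).eval t₂ = 0) (hv₂ : (z₂, t₂) ∈ v) :
    False := by
  have hcov' : ∀ z t, eval z g ≠ 0 → (spec F z).eval t = 0 → (z, t) ∈ v ∨ (z, t) ∈ u :=
    fun z t hz ht ↦ (hcov z t hz ht).symm
  have hdisj' : ∀ z t, eval z g ≠ 0 → (spec F z).eval t = 0 → (z, t) ∈ v → (z, t) ∉ u :=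
    fun z t hz ht htv htu ↦ hdisj z t hz ht htu htv
  obtain ⟨Qu, hQu, hdu, hQu'⟩ := exists_Q hF hsep hu hv hcov hdisj hg hz₁
  obtain ⟨Qv, hQv, hdv, hQv'⟩ := exists_Q hF hsep hv hu hcov' hdisj' hg hz₂
  -- `Qu * Qv = F`: their specialisations agree on the nonempty open `V`
  have hprod : Qu * Qv = F := by
    rw [← sub_eq_zero]
    refine Polynomial.ext fun i ↦ ?_
    rw [Polynomial.coeff_zero]
    refine eq_zero_of_forall_eval_eq_zero_of_isOpen (isOpen_setOf_eval_ne_zero g)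
      (exists_eval_ne_zero hg) fun z hz ↦ ?_
    have h1 : spec (Qu * Qv) z = spec F z := by
      rw [spec, Polynomial.map_mul]
      change spec Qu z * spec Qv z = spec F z
      rw [hQu' z hz, hQv' z hz, uPoly_mul_uPoly hF hsep hcov hdisj hz]
    have h2 := congrArg (fun q : Polynomial ℂ ↦ q.coeff i) h1
    simp only [Polynomial.coeff_map] at h2
    rw [Polynomial.coeff_sub, map_sub, sub_eq_zero]
    exact h2
  -- both factors have positive degree
  have hmu : 0 < Qu.natDegree := by
    rw [hdu, Finset.card_pos]
    exact ⟨t₁, mem_uRoots.mpr ⟨(mem_fiber hF).mpr ht₁, hu₁⟩⟩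
  have hmv : 0 < Qv.natDegree := by
    rw [hdv, Finset.card_pos]
    exact ⟨t₂, mem_uRoots.mpr ⟨(mem_fiber hF).mpr ht₂, hv₂⟩⟩
  rcases hirr Qu Qv hQu hQv hprod with h | h
  · exact hmu.ne' h
  · exact hmv.ne' h

end Cover

/-! ### The theorem -/

/-- **The unramified part of an irreducible hypersurface cover is connected** (the statement
«`U(ℂ)` is connected» of Shafarevich's second proof of Theorem 7.1). Let `F ∈ ℂ[z₁, …, z_r][T]`
be monic of positive degree and not a product of two monic polynomials of positive degree, and
let `g ≠ 0` be such that `F(z, ·)` is separable whenever `g(z) ≠ 0`. Then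
`{(z, t) | g(z) ≠ 0, F(z, t) = 0} ⊆ ℂʳ × ℂ` is preconnected.
[cite: Shafarevich1994, Book 3 Ch. VII §2.3 (second proof of Thm. 7.1)] -/
theorem isPreconnected {F : Polynomial (MvPolynomial (Fin r) ℂ)} {g : MvPolynomial (Fin r) ℂ}
    (hF : F.Monic)
    (hirr : ∀ Q₁ Q₂ : Polynomial (MvPolynomial (Fin r) ℂ), Q₁.Monic → Q₂.Monic → Q₁ * Q₂ = F →
      Q₁.natDegree = 0 ∨ Q₂.natDegree = 0)
    (hg : g ≠ 0) (hsep : ∀ z, eval z g ≠ 0 → (spec F z).Separable) :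
    IsPreconnected {p : (Fin r → ℂ) × ℂ | eval p.1 g ≠ 0 ∧ (spec F p.1).eval p.2 = 0} := by
  intro u v hu hv hUV ⟨p₁, hp₁, hp₁u⟩ ⟨p₂, hp₂, hp₂v⟩
  by_contra hempty
  have hdisj : ∀ z t, eval z g ≠ 0 → (spec F z).eval t = 0 → (z, t) ∈ u → (z, t) ∉ v :=
    fun z t hz ht hzu hzv ↦ hempty ⟨(z, t), ⟨hz, ht⟩, hzu, hzv⟩
  have hcov : ∀ z t, eval z g ≠ 0 → (spec F z).eval t = 0 → (z, t) ∈ u ∨ (z, t) ∈ v :=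
    fun z t hz ht ↦ hUV ⟨hz, ht⟩
  exact false_of_nonempty hF hsep hu hv hcov hdisj hg hirr hp₁.1 hp₁.2 hp₁u hp₂.1 hp₂.2 hp₂v

/-- **The unramified part of an irreducible hypersurface cover is connected** (with
nonemptiness: `F` has positive degree, `g ≠ 0`, `ℂ` is algebraically closed).
[cite: Shafarevich1994, Book 3 Ch. VII §2.3 (second proof of Thm. 7.1)] -/
theorem isConnected {F : Polynomial (MvPolynomial (Fin r) ℂ)} {g : MvPolynomial (Fin r) ℂ}
    (hF : F.Monic) (hdeg : 0 < F.natDegree)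
    (hirr : ∀ Q₁ Q₂ : Polynomial (MvPolynomial (Fin r) ℂ), Q₁.Monic → Q₂.Monic → Q₁ * Q₂ = F →
      Q₁.natDegree = 0 ∨ Q₂.natDegree = 0)
    (hg : g ≠ 0) (hsep : ∀ z, eval z g ≠ 0 → (spec F z).Separable) :
    IsConnected {p : (Fin r → ℂ) × ℂ | eval p.1 g ≠ 0 ∧ (spec F p.1).eval p.2 = 0} := by
  refine ⟨?_, isPreconnected hF hirr hg hsep⟩
  obtain ⟨z, hz⟩ := exists_eval_ne_zero hg
  have hd : 0 < (spec F z).degree := by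
    rw [Polynomial.degree_eq_natDegree (spec_ne_zero hF z), natDegree_spec hF]
    exact_mod_cast hdeg
  obtain ⟨t, ht⟩ := Complex.exists_root hd
  exact ⟨(z, t), hz, ht⟩

end HypersurfaceCover

end Literature.NumberTheory.Transcendental
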